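import Literature.AlgebraicGeometry.Dimension.FibreLocalRingDimension
import Literature.AlgebraicGeometry.Morphisms.FiniteOfClosedFibres
import Mathlib.AlgebraicGeometry.Morphisms.Smooth
import HarnessLib

/-!
# Fibres of dimension one: no chains of length two, finiteness of the non-smooth locus

Topic: `Literature/AlgebraicGeometry/Resolution`. Two topological facts about a fibre `X_y` of a
morphism `f : X → Y` all of whose irreducible components have dimension `≤ 1`, used in the
proof of de Jong's Lemma 4.13 (de Jong 1996, pp. 69–70: "a finite number of curves in
`f⁻¹(y)`", "`(f⁻¹(y) ∩ Sing(f))_red`, i.e. a finite set of points"):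

* `not_specializes_specializes_of_dim_le_one` — there is no chain of proper specialisations
  `a ⤳ b ⤳ c` in such a scheme;
* `finite_univ_of_topologicalKrullDim_le_zero` — a Noetherian sober `T₀` space of Krull
  dimension `≤ 0` is finite;
* **`finite_preimage_singleton_inter_compl_smoothLocus`** — if moreover the smooth locus of `f`
  is dense in the fibre, then `f⁻¹(y) ∖ sm(f)` is a finite set.

## References

* A. J. de Jong, *Smoothness, semi-stability and alterations*, Publ. Math. IHÉS 83 (1996),
  Lemma 4.13 (proof), pp. 69–70. [DeJong1996]
-/

noncomputable section

universe u

open CategoryTheory AlgebraicGeometry Order Topology TopologicalSpace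

namespace Literature.AlgebraicGeometry.Resolution

/-! ### Chains of length two are impossible in a scheme of dimension `≤ 1` -/

/-- In a scheme all of whose irreducible components have dimension `≤ 1` there is no chain of
proper specialisations `a ⤳ b ⤳ c`. [folklore] -/
theorem not_specializes_specializes_of_dim_le_one {F : Scheme.{u}}
    (hdim : ∀ C ∈ irreducibleComponents (F : Type u), topologicalKrullDim C ≤ (1 : ℕ))
    {a b c : F} (hab : a ⤳ b) (hbc : b ⤳ c) (hab' : a ≠ b) (hbc' : b ≠ c) : False := by
  have hF : topologicalKrullDim F ≤ (1 : ℕ) :=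
    Literature.AlgebraicGeometry.Dimension.topologicalKrullDim_le_of_forall_mem_irreducibleComponents
      F 1 hdim
  rw [show topologicalKrullDim F = krullDim F from
    krullDim_eq_of_orderIso (irreducibleSetEquivPoints (α := F))] at hF
  -- the chain `c < b < a`
  have hcb : c < b := lt_of_le_not_ge (Scheme.le_iff_specializes.mpr hbc)
    (fun h => hbc' (hbc.antisymm (Scheme.le_iff_specializes.mp h)).eq)
  have hba : b < a := lt_of_le_not_ge (Scheme.le_iff_specializes.mpr hab)
    (fun h => hab' (hab.antisymm (Scheme.le_iff_specializes.mp h)).eq)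
  have hmono : StrictMono ![c, b, a] := by
    rw [Fin.strictMono_iff_lt_succ]
    intro i
    fin_cases i
    · exact hcb
    · exact hba
  let p : LTSeries F := LTSeries.mk 2 ![c, b, a] hmono
  have h2 : ((2 : ℕ) : WithBot ℕ∞) ≤ krullDim F := p.length_le_krullDim
  have : ((2 : ℕ) : WithBot ℕ∞) ≤ (1 : ℕ) := h2.trans hF
  exact absurd this (by decide)

/-- In such a scheme, an irreducible component containing a proper specialisation `a ⤳ b` is the
closure of `a` (its generic point cannot lie strictly above `a`). [folklore] -/
theorem eq_closure_of_specializes_of_dim_le_one {F : Scheme.{u}}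
    (hdim : ∀ C ∈ irreducibleComponents (F : Type u), topologicalKrullDim C ≤ (1 : ℕ))
    {a b : F} (hab : a ⤳ b) (hab' : a ≠ b) {C : Set F} (hC : C ∈ irreducibleComponents (F : Type u))
    (haC : a ∈ C) : C = closure {a} := by
  have hCcl : IsClosed C := isClosed_of_mem_irreducibleComponents C hC
  obtain ⟨ξ, hξ⟩ := QuasiSober.sober hC.1 hCcl
  have hξC : closure ({ξ} : Set F) = C := hξ.def
  have hξa : ξ ⤳ a := by
    rw [specializes_iff_closure_subset, hξC]
    exact closure_minimal (Set.singleton_subset_iff.mpr haC) hCcl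
  by_cases hne : ξ = a
  · rw [← hξC, hne]
  · exact (not_specializes_specializes_of_dim_le_one hdim hξa hab hne hab').elim

/-! ### Noetherian sober spaces of dimension `≤ 0` are finite -/

/-- A Noetherian sober `T₀` space of Krull dimension `≤ 0` is finite: all its points are closed,
so each of its finitely many irreducible components is a single point. [folklore] -/
theorem finite_univ_of_topologicalKrullDim_le_zero {Z : Type u} [TopologicalSpace Z] [T0Space Z]
    [QuasiSober Z] [NoetherianSpace Z] (h : topologicalKrullDim Z ≤ 0) :
    (Set.univ : Set Z).Finite := by
  have hpt : ∀ x : Z, IsClosed ({x} : Set Z) :=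
    Literature.AlgebraicGeometry.Morphisms.isClosed_singleton_of_topologicalKrullDim_le_zero h
  have hcomp : ∀ C ∈ irreducibleComponents Z, ∃ x, C = {x} := by
    intro C hC
    obtain ⟨x, hx⟩ := (hC.1).nonempty
    refine ⟨x, Set.Subset.antisymm (fun z hz => ?_) (Set.singleton_subset_iff.mpr hx)⟩
    have hCcl : IsClosed C := isClosed_of_mem_irreducibleComponents C hC
    obtain ⟨ξ, hξ⟩ := QuasiSober.sober hC.1 hCcl
    have hξC : closure ({ξ} : Set Z) = C := hξ.def
    have hξx : ξ = x := by
      have : x ∈ closure ({ξ} : Set _) := hξC ▸ hx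
      rwa [(hpt ξ).closure_eq, Set.mem_singleton_iff, eq_comm] at this
    have : z ∈ closure ({ξ} : Set _) := hξC ▸ hz
    rw [(hpt ξ).closure_eq, Set.mem_singleton_iff] at this
    rw [Set.mem_singleton_iff, this, hξx]
  have hU : (Set.univ : Set Z) = ⋃₀ irreducibleComponents Z :=
    (sUnion_irreducibleComponents (X := Z)).symm
  rw [hU]
  refine Set.Finite.sUnion NoetherianSpace.finite_irreducibleComponents fun C hC => ?_
  obtain ⟨x, rfl⟩ := hcomp C hC
  exact Set.finite_singleton x

/-- A closed subset of Krull dimension `≤ 0` of a Noetherian sober `T₀` space is finite.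
[folklore] -/
theorem finite_of_isClosed_of_topologicalKrullDim_le_zero {Z : Type u} [TopologicalSpace Z]
    [T0Space Z] [QuasiSober Z] [NoetherianSpace Z] {T : Set Z} (hT : IsClosed T)
    (h : topologicalKrullDim ↥T ≤ 0) : T.Finite := by
  haveI : QuasiSober ↥T := Literature.Topology.quasiSober_of_isClosed hT
  have := finite_univ_of_topologicalKrullDim_le_zero (Z := ↥T) h
  have hT' : T = ((↑) : ↥T → Z) '' Set.univ := by simp
  rw [hT']
  exact this.image _

/-! ### The non-smooth locus of a fibre with dense smooth locus is finite -/

section Smooth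

variable {X Y : Scheme.{u}} (f : X ⟶ Y) [LocallyOfFinitePresentation f] [QuasiCompact f]

/-- **A closed nowhere dense subset of a fibre of dimension `≤ 1` is finite.** If every
irreducible component of `X_y` has dimension `≤ 1` and `T ⊆ X_y` is closed with dense
complement, then `T` is finite: a proper specialisation `z₀ ⤳ z₁` inside `T` would make the
component of `X_y` through `z₀` equal to `closure {z₀} ⊆ T`, and a component contains a
non-empty open subset of `X_y`. [folklore] -/
theorem finite_of_isClosed_of_dense_compl {y : Y}
    (hdim : ∀ C ∈ irreducibleComponents ↥(f.fiber y), topologicalKrullDim ↥C ≤ (1 : ℕ))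
    {T : Set ↥(f.fiber y)} (hT : IsClosed T) (hdense : Dense Tᶜ) : T.Finite := by
  haveI : LocallyOfFiniteType (f.fiberToSpecResidueField y) :=
    MorphismProperty.pullback_snd _ _ inferInstance
  haveI : IsLocallyNoetherian (f.fiber y) :=
    LocallyOfFiniteType.isLocallyNoetherian (f.fiberToSpecResidueField y)
  haveI : IsNoetherian (f.fiber y) := { }
  haveI : NoetherianSpace ↥(f.fiber y) := inferInstance
  haveI : QuasiSober ↥T := Literature.Topology.quasiSober_of_isClosed hT
  apply finite_of_isClosed_of_topologicalKrullDim_le_zero hT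
  -- no proper specialisation inside `T`
  by_contra hcon
  push Not at hcon
  rw [Literature.Topology.topologicalKrullDim_eq_krullDim] at hcon
  obtain ⟨a, b, hab⟩ := (@Order.krullDim_pos_iff ↥T (specializationOrder ↥T).toPreorder).mp hcon
  have hle' : (b : ↥T) ⤳ a := @le_of_lt ↥T (specializationOrder ↥T).toPreorder _ _ hab
  have hba : (b : ↥(f.fiber y)) ⤳ (a : ↥(f.fiber y)) := hle'.map continuous_subtype_val
  have hne'' : a ≠ b := @ne_of_lt ↥T (specializationOrder ↥T).toPreorder _ _ hab
  have hne : (b : ↥(f.fiber y)) ≠ a := fun h => hne'' (Subtype.ext h).symm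
  -- the component through `b` is `closure {b} ⊆ T`
  obtain ⟨C, hC, hbC⟩ : ∃ C ∈ irreducibleComponents ↥(f.fiber y), (b : ↥(f.fiber y)) ∈ C := by
    have : (b : ↥(f.fiber y)) ∈ ⋃₀ irreducibleComponents ↥(f.fiber y) := by
      rw [sUnion_irreducibleComponents]; trivial
    simpa only [Set.mem_sUnion] using this
  have hCeq := eq_closure_of_specializes_of_dim_le_one hdim hba hne hC hbC
  have hCT : C ⊆ T := by
    rw [hCeq]
    exact closure_minimal (Set.singleton_subset_iff.mpr b.2) hT
  -- `C` contains the non-empty open complement of the other components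
  set R : Set ↥(f.fiber y) := ⋃₀ (irreducibleComponents ↥(f.fiber y) \ {C}) with hR
  have hRcl : IsClosed R := by
    rw [hR, Set.sUnion_eq_biUnion]
    exact Set.Finite.isClosed_biUnion (NoetherianSpace.finite_irreducibleComponents.subset
      Set.sdiff_subset) fun C' hC' => isClosed_of_mem_irreducibleComponents C' hC'.1
  have hbR : (b : ↥(f.fiber y)) ∉ R := by
    rintro ⟨C', ⟨hC', hC'C⟩, hbC'⟩
    apply hC'C
    rw [Set.mem_singleton_iff]
    -- `C = closure {b} ⊆ C'`, so `C = C'` by maximality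
    have hsub : C ⊆ C' := by
      rw [hCeq]
      exact closure_minimal (Set.singleton_subset_iff.mpr hbC')
        (isClosed_of_mem_irreducibleComponents C' hC')
    exact (hC.2 hC'.1 hsub).antisymm hsub
  have hopen : IsOpen Rᶜ := hRcl.isOpen_compl
  have hsubT : Rᶜ ⊆ T := by
    intro z hz
    have hz' : z ∈ ⋃₀ irreducibleComponents ↥(f.fiber y) := by
      rw [sUnion_irreducibleComponents]; trivial
    obtain ⟨C', hC', hzC'⟩ := hz'
    by_cases hCC : C' = C
    · exact hCT (hCC ▸ hzC')
    · exact absurd ⟨C', ⟨hC', hCC⟩, hzC'⟩ hz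
  obtain ⟨z, hzR, hzT⟩ := hdense.inter_open_nonempty Rᶜ hopen ⟨b, hbR⟩
  exact hzT (hsubT hzR)

/-- **The non-smooth locus of a fibre with dense smooth locus is finite**: if every irreducible
component of `X_y` has dimension `≤ 1` and `sm(f)` is dense in `X_y`, then `f⁻¹(y) ∖ sm(f)` is
a finite set (de Jong: "`(f⁻¹(y) ∩ Sing(f))_red`, i.e. a finite set of points").
[cite: DeJong1996, Lemma 4.13 (proof), p. 70] -/
theorem finite_preimage_singleton_inter_compl_smoothLocus {y : Y}
    (hdim : ∀ C ∈ irreducibleComponents ↥(f.fiber y), topologicalKrullDim ↥C ≤ (1 : ℕ))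
    (hdense : Dense ((f.fiberι y) ⁻¹' (f.smoothLocus : Set X))) :
    (f ⁻¹' {y} ∩ (f.smoothLocus : Set X)ᶜ).Finite := by
  set T : Set ↥(f.fiber y) := (f.fiberι y) ⁻¹' (f.smoothLocus : Set X)ᶜ with hT
  have hTcl : IsClosed T := f.smoothLocus.2.isClosed_compl.preimage (f.fiberι y).continuous
  have hTc : Tᶜ = (f.fiberι y) ⁻¹' (f.smoothLocus : Set X) := by
    rw [hT, Set.preimage_compl, compl_compl]
  have hfin := finite_of_isClosed_of_dense_compl f hdim hTcl (hTc ▸ hdense)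
  have heq : f ⁻¹' {y} ∩ (f.smoothLocus : Set X)ᶜ = (f.fiberι y) '' T := by
    ext x
    constructor
    · rintro ⟨hx, hxs⟩
      rw [← Scheme.Hom.range_fiberι] at hx
      obtain ⟨z, rfl⟩ := hx
      exact ⟨z, hxs, rfl⟩
    · rintro ⟨z, hz, rfl⟩
      refine ⟨?_, hz⟩
      rw [← Scheme.Hom.range_fiberι]
      exact ⟨z, rfl⟩
  rw [heq]
  exact hfin.image _

end Smooth

end Literature.AlgebraicGeometry.Resolution
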